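import Literature.MathematicalPhysics.QuantumFieldTheory.Balaban1983to89.MatrixNorms
import Summits.QuantumFields.YangMills.Theorems.BalabanUVNodesK0Stub1V0SlotAtRecord

/-!
# BalabanUVNodes ∕ K0⁷ stub 1 (`stub_prop8StepCoP13`), sub-target S4b — THE RECORD's FIBRE LETTERS `τ_N = N⁻¹tr` AND ITS DUALISER `ρ_N` ON `M_N(ℂ)`,
# and [Balaban1985Variational] Prop. 4's V₀-group current at the flat background on `PBond P 0 → M_N(ℂ)` with EVERY LETTER A NUMBER
# (`C₄ = 202·(d − 1)·N³` at `a₃ = 1/16`, `c = L^k`)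

Cell `pub-ymgap`, width seat `pub-ymgap-k0-s1-w2` (g0; HUMAN RULING D-0149), K0⁷ **stmt-QuantumFields-20541**; `--kind proof --supports stmt-QuantumFields-20541
--as helper`; count-neutral.  [15] = T. Bałaban, CMP **102** (1985) 277–309; [4] = [Balaban1985Averaging] (17), (20) p. 20–21 (`MatrixNorms`).

WHY.  This seat's `Thm/BalabanUVNodesK0Stub1V0SlotAtRecord.exists_W_V0_flat` (p587784) gives the V₀ summand of Sect. F's (158) map `W` on the Setup torus for ANY
complete unital finite-dimensional `*`-algebra `𝔸` and LETTERS `ρ, τ` — `τ` tracial, `*`-compatible, contractive, `ρ` dualising the bilinear trace pairing (27),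
`τ(ρ(ℓ)·X) = ℓ(X)` — with the constant `(d−1)‖ρ‖(64+138‖τ‖)`.  The pub-balaban NE9 chain and the lit-balaban V₀ files display the same two letters («the (L3)
slot's own letters ρ, τc»).  At NODE 00's record the fibre is `M_N(ℂ)` (N = 2) with the operator norm (`Matrix.Norms.L2Operator`) and the normalised trace of
[4] (17) (`MatrixNorms.ntr`; n07-w1's `trN_*`, p583227).  THIS FILE discharges both letters there: `τ_N = N⁻¹tr` as a continuous functional (contractive by [4] (20)
`MatrixNorms.norm_ntr_le_opNorm`) and the dualiser `ρ_N(ℓ) = N·Σ_{ij} ℓ(E_ij)E_ji` (`tr(E_ji X) = X_ij`), of norm `≤ N³` (`‖E_ij‖ ≤ 1` by `MatrixNorms.opNorm_sq_le_sum_norm_sq`);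
hence the V₀-group slot at the record with the NUMERICAL constant `202·(d−1)·N³`.

CONTENTS (theorems only; 0 `def`; letters existentially packaged with their defining properties).  §1 `norm_single_one_le`; ★ `exists_fibreLetters (N) [NeZero N]`
(`∃ τ ρ`: `τ X = ntr X`, tracial, `*`-compatible, contractive, `τ 1 = 1`, `τ(ρ(ℓ)X) = ℓ X`, `‖ρ ℓ‖ ≤ N³‖ℓ‖`).  §3a `exists_W_V0_flat_of_letterBound` (abstract `𝔸`: letter
BOUNDS `‖ρ ℓ‖ ≤ M_ρ‖ℓ‖`, `‖τ X‖ ≤ ‖X‖` ⇒ `C₄ = 202·(d−1)·M_ρ`).  §3 ★★ `exists_W_V0_flat_matrix (N) (P) (hd : 4 ≤ P.d) (k)`: `∃ τ ρ e W` on `PBond P 0 → M_N(ℂ)` —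
`τ = ntr`, the dualising identity, the dictionary law, UST's `hWq` with `C₄ = 202·(d−1)·N³` at `a₃ = 1/16`, `c = L^k`, `Differentiable ℂ W`, and the (63)∕(27) certificate
`⟨W(Y), δ⟩ = (d/dt)V₀(Y + tδ)|₀` for pv27's `V0` at `shiftEquiv = torusT P 0`, flat datum.

HONEST FRAMING.  [folklore] matrix algebra + instantiation of p587784; V₀-group ONLY (the `H`∕(47) summands of Sect. F's `W` are S1∕S2's); nothing of [15]'s analysis
asserted beyond the cited kernel theorems; K0⁷ OPEN; N07 NOT discharged; counts unmoved (5∕27); one finite 𝕋⁴ programme at fixed ε — R4 closes the conditional rung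
`BalabanLadder.UV` only; the YM mass gap (Clay) is NOT proved by any of this; nothing continuum ∕ ℝ⁴ ∕ OS.  0 `sorry`, 0 `def`, 0 `instance`, standard axioms.
-/

noncomputable section

namespace Summit.QuantumFields.YangMills.Theorems.K0Stub1FibreTraceLetters

open scoped Matrix.Norms.L2Operator
open Literature.MathematicalPhysics.QuantumFieldTheory.Balaban1983to89
open MatrixNorms (ntr norm_ntr_le_opNorm opNorm_sq_le_sum_norm_sq)

variable (N : ℕ) [NeZero N]

omit [NeZero N] in
/-- The matrix unit `E_ij` has operator norm at most one (`‖X‖² ≤ Σ|X_ab|²`, [4] (20) via `MatrixNorms.opNorm_sq_le_sum_norm_sq`).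
[cite: Balaban1985Averaging, (20) p.21] -/
theorem norm_single_one_le (i j : Fin N) : ‖(Matrix.single i j (1 : ℂ) : Matrix (Fin N) (Fin N) ℂ)‖ ≤ 1 := by
  have h := opNorm_sq_le_sum_norm_sq (Matrix.single i j (1 : ℂ) : Matrix (Fin N) (Fin N) ℂ)
  have hs : ∑ a : Fin N, ∑ b : Fin N, ‖(Matrix.single i j (1 : ℂ) : Matrix (Fin N) (Fin N) ℂ) a b‖ ^ 2 = 1 := by
    rw [Finset.sum_eq_single i, Finset.sum_eq_single j]
    · simp
    · intro b _ hb; simp [hb.symm]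
    · intro h; exact absurd (Finset.mem_univ j) h
    · intro a _ ha; apply Finset.sum_eq_zero; intro b _; simp [ha.symm]
    · intro h; exact absurd (Finset.mem_univ i) h
  rw [hs] at h
  nlinarith [norm_nonneg (Matrix.single i j (1 : ℂ) : Matrix (Fin N) (Fin N) ℂ)]

/-- **THE FIBRE LETTERS OF THE RECORD EXIST**: on `M_N(ℂ)` with the operator norm, the normalised trace `τ_N = N⁻¹tr` of [4] (17) as a continuous linear
functional — tracial, `*`-compatible, contractive ([4] (20) «|tr X| ≤ |X|»), `τ_N 1 = 1` — together with a DUALISER `ρ_N` of the bilinear trace pairing (27) of [15],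
`τ_N(ρ_N(ℓ)·X) = ℓ(X)` (`ρ_N(ℓ) = N·Σ_{ij} ℓ(E_ij)E_ji`), with `‖ρ_N(ℓ)‖ ≤ N³‖ℓ‖`. [cite: Balaban1985Averaging, (17) p.20, (20) p.21; Balaban1985Variational, (27) p.282] -/
theorem exists_fibreLetters :
    ∃ (τ : Matrix (Fin N) (Fin N) ℂ →L[ℂ] ℂ) (ρ : (Matrix (Fin N) (Fin N) ℂ →L[ℂ] ℂ) →L[ℂ] Matrix (Fin N) (Fin N) ℂ),
      (∀ X, τ X = ntr X) ∧ (∀ a b, τ (a * b) = τ (b * a)) ∧ (∀ a, τ (star a) = starRingEnd ℂ (τ a)) ∧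
      (∀ X, ‖τ X‖ ≤ ‖X‖) ∧ τ 1 = 1 ∧ (∀ ℓ X, τ (ρ ℓ * X) = ℓ X) ∧ (∀ ℓ, ‖ρ ℓ‖ ≤ (N : ℝ) ^ 3 * ‖ℓ‖) := by
  classical
  have hN : (N : ℂ) ≠ 0 := Nat.cast_ne_zero.mpr (NeZero.ne N)
  let τₗ : Matrix (Fin N) (Fin N) ℂ →ₗ[ℂ] ℂ := (N : ℂ)⁻¹ • Matrix.traceLinearMap (Fin N) ℂ ℂ
  let τ : Matrix (Fin N) (Fin N) ℂ →L[ℂ] ℂ := LinearMap.toContinuousLinearMap τₗ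
  have hτ : ∀ X, τ X = ntr X := fun X => by
    show (N : ℂ)⁻¹ • Matrix.trace X = Matrix.trace X / Fintype.card (Fin N)
    rw [Fintype.card_fin, smul_eq_mul, div_eq_inv_mul]
  let ρₗ : (Matrix (Fin N) (Fin N) ℂ →L[ℂ] ℂ) →ₗ[ℂ] Matrix (Fin N) (Fin N) ℂ :=
    { toFun := fun ℓ => (N : ℂ) • ∑ i : Fin N, ∑ j : Fin N, ℓ (Matrix.single i j 1) • Matrix.single j i (1 : ℂ)
      map_add' := fun ℓ ℓ' => by
        simp only [FunLike.coe_add, Pi.add_apply, add_smul, Finset.sum_add_distrib, smul_add]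
      map_smul' := fun c ℓ => by
        simp only [FunLike.coe_smul, Pi.smul_apply, smul_eq_mul, mul_smul, ← Finset.smul_sum, RingHom.id_apply]
        rw [smul_comm] }
  let ρ : (Matrix (Fin N) (Fin N) ℂ →L[ℂ] ℂ) →L[ℂ] Matrix (Fin N) (Fin N) ℂ := LinearMap.toContinuousLinearMap ρₗ
  have hρ_apply : ∀ ℓ, ρ ℓ = (N : ℂ) • ∑ i : Fin N, ∑ j : Fin N, ℓ (Matrix.single i j 1) • Matrix.single j i (1 : ℂ) :=
    fun ℓ => rfl
  refine ⟨τ, ρ, hτ, fun a b => ?_, fun a => ?_, fun X => ?_, ?_, fun ℓ X => ?_, fun ℓ => ?_⟩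
  · show (N : ℂ)⁻¹ • Matrix.trace (a * b) = (N : ℂ)⁻¹ • Matrix.trace (b * a)
    rw [Matrix.trace_mul_comm]
  · show (N : ℂ)⁻¹ • Matrix.trace (star a) = starRingEnd ℂ ((N : ℂ)⁻¹ • Matrix.trace a)
    rw [Matrix.star_eq_conjTranspose, Matrix.trace_conjTranspose, smul_eq_mul, smul_eq_mul, map_mul, map_inv₀,
      Complex.conj_natCast, Complex.star_def]
  · rw [hτ]; exact norm_ntr_le_opNorm X
  · show (N : ℂ)⁻¹ • Matrix.trace (1 : Matrix (Fin N) (Fin N) ℂ) = 1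
    rw [Matrix.trace_one, Fintype.card_fin, smul_eq_mul, inv_mul_cancel₀ hN]
  · -- the dualising identity
    show (N : ℂ)⁻¹ • Matrix.trace (ρ ℓ * X) = ℓ X
    rw [hρ_apply, smul_mul_assoc, Matrix.trace_smul, smul_smul, inv_mul_cancel₀ hN, one_smul, Finset.sum_mul,
      Matrix.trace_sum]
    simp_rw [Finset.sum_mul, Matrix.trace_sum, smul_mul_assoc, Matrix.trace_smul, Matrix.trace_single_mul, one_smul,
      smul_eq_mul]
    conv_rhs => rw [Matrix.matrix_eq_sum_single X, map_sum]
    refine Finset.sum_congr rfl fun i _ => ?_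
    rw [map_sum]
    refine Finset.sum_congr rfl fun j _ => ?_
    rw [show Matrix.single i j (X i j) = X i j • Matrix.single i j (1 : ℂ) by rw [Matrix.smul_single, smul_eq_mul, mul_one],
      map_smul, smul_eq_mul, mul_comm]
  · -- the norm of the dualiser
    rw [hρ_apply, norm_smul, Complex.norm_natCast]
    have h1 : ∀ i j : Fin N, ‖ℓ (Matrix.single i j 1) • Matrix.single j i (1 : ℂ)‖ ≤ ‖ℓ‖ := fun i j => by
      rw [norm_smul]
      calc ‖ℓ (Matrix.single i j 1)‖ * ‖Matrix.single j i (1 : ℂ)‖ ≤ (‖ℓ‖ * ‖Matrix.single i j (1 : ℂ)‖) * 1 :=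
            mul_le_mul (ℓ.le_opNorm _) (norm_single_one_le N j i) (norm_nonneg _) (by positivity)
        _ ≤ (‖ℓ‖ * 1) * 1 := by gcongr; exact norm_single_one_le N i j
        _ = ‖ℓ‖ := by ring
    calc (N : ℝ) * ‖∑ i : Fin N, ∑ j : Fin N, ℓ (Matrix.single i j 1) • Matrix.single j i (1 : ℂ)‖
        ≤ (N : ℝ) * ∑ i : Fin N, ∑ j : Fin N, ‖ℓ‖ := by
          gcongr
          exact (norm_sum_le _ _).trans (Finset.sum_le_sum fun i _ => (norm_sum_le _ _).trans (Finset.sum_le_sum fun j _ => h1 i j))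
      _ = (N : ℝ) ^ 3 * ‖ℓ‖ := by simp [Finset.sum_const, Finset.card_univ, Fintype.card_fin]; ring


/-! ## §3a The slot's constant from LETTER BOUNDS (abstract fibre): `‖ρ ℓ‖ ≤ M_ρ‖ℓ‖`, `‖τ X‖ ≤ ‖X‖` ⇒ `C₄ = 202·(d−1)·M_ρ` -/

section LetterBounds

open Literature.MathematicalPhysics.QuantumFieldTheory.Balaban1983to89.B11Eq63V0GroupCurrent (curV0)
open Literature.MathematicalPhysics.QuantumFieldTheory.Balaban1983to89.B11Eq90V0primeCurrent (Tsh Ucur curL)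
open Literature.MathematicalPhysics.QuantumFieldTheory.Balaban1983to89.B11Eq111FrakG (nabla115)
open Literature.MathematicalPhysics.QuantumFieldTheory.Balaban1983to89.B11Eq115Space
open Summit.QuantumFields.YangMills.Theorems.K0Stub1V0SlotAtRecord (exists_W_V0_flat)

variable {𝔸 : Type*} [NormedRing 𝔸] [NormedAlgebra ℂ 𝔸] [CompleteSpace 𝔸] [NormOneClass 𝔸] [StarRing 𝔸] [StarModule ℂ 𝔸]
  [FiniteDimensional ℂ 𝔸]

/-- **`exists_W_V0_flat` WITH A NUMERICAL CONSTANT FROM LETTER BOUNDS**: if `‖ρ(ℓ)‖ ≤ M_ρ‖ℓ‖` and `τ` is contractive then the slot holds with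
`C₄ = 202·(d − 1)·M_ρ` (`‖ρ‖ ≤ M_ρ`, `‖τ‖ ≤ 1`, `64 + 138 ≤ 202`). [cite: Balaban1985Variational, (98) p.293] -/
theorem exists_W_V0_flat_of_letterBound (P : Params) (hd : 4 ≤ P.d) (k : ℕ) [Fact ((0 : ℝ) < (P.L : ℝ))]
    [Fact ((0 : ℝ) < ((P.L : ℝ))⁻¹ ^ k)]
    (ρ : (𝔸 →L[ℂ] ℂ) →L[ℂ] 𝔸) (τ : 𝔸 →L[ℂ] ℂ) (hρ : ∀ (ℓ : 𝔸 →L[ℂ] ℂ) (X : 𝔸), τ (ρ ℓ * X) = ℓ X)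
    (hτ : ∀ a b : 𝔸, τ (a * b) = τ (b * a)) (hτs : ∀ a : 𝔸, τ (star a) = starRingEnd ℂ (τ a)) (hτ1 : ∀ X : 𝔸, ‖τ X‖ ≤ ‖X‖)
    {Mρ : ℝ} (hMρ : 0 ≤ Mρ) (hρb : ∀ ℓ, ‖ρ ℓ‖ ≤ Mρ * ‖ℓ‖) :
    ∃ (e : Site P 0 ≃ B4Sect5Torus.TSite P.d (fun _ => P.sitesPerDir 0)) (W : (PBond P 0 → 𝔸) → (PBond P 0 → 𝔸)),
      (∀ (x : Site P 0) (μ : Fin P.d), e (x.shift μ) = B9SectCLatticeCarrier.shift μ (e x)) ∧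
      (∀ (Y : PBond P 0 → 𝔸) (r : ℝ), r < 1 / 16 → (∀ b, ‖Y b‖ ≤ r) →
        (∀ (s : Site P 0) (μ ν : Fin P.d), (P.L : ℝ) ^ k * ‖Y ⟨s.shift ν, μ⟩ - Y ⟨s, μ⟩‖ ≤ r) →
        ∀ b, ‖W Y b‖ ≤ (202 * ((P.d - 1 : ℕ) : ℝ) * Mρ) * r ^ 2) ∧
      Differentiable ℂ W ∧
      (∀ (Y δ : PBond P 0 → 𝔸),
        B9Eq39Adjoint.bondPair (((P.L : ℝ))⁻¹ ^ k) P.d (τ : 𝔸 →ₗ[ℂ] ℂ) (fun μ x => W Y ⟨x, μ⟩) (fun μ x => δ ⟨x, μ⟩)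
          = deriv (fun t : ℂ => B11Eq26ActionExpansion.V0 (LatticeFieldCalculus.shiftEquiv (P := P) (j := 0))
              (fun _ _ => (1 : 𝔸ˣ)) (((P.L : ℝ))⁻¹ ^ k) P.d (τ : 𝔸 →ₗ[ℂ] ℂ) ((fun μ x => Y ⟨x, μ⟩) + t • fun μ x => δ ⟨x, μ⟩)) 0) := by
  obtain ⟨e, W, he, -, hq, hdiff, -, hcert⟩ := exists_W_V0_flat (𝔸 := 𝔸) P hd k ρ τ hρ hτ hτs hτ1
  have hτn : ‖τ‖ ≤ 1 := ContinuousLinearMap.opNorm_le_bound τ zero_le_one fun X => by rw [one_mul]; exact hτ1 X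
  have hρN : ‖ρ‖ ≤ Mρ := ContinuousLinearMap.opNorm_le_bound ρ hMρ hρb
  refine ⟨e, W, he, fun Y r hr h0 h1 b => ?_, hdiff, hcert⟩
  calc ‖W Y b‖ ≤ (((P.d - 1 : ℕ) : ℝ) * ‖ρ‖ * (64 + 138 * ‖τ‖)) * r ^ 2 := hq Y r hr h0 h1 b
    _ ≤ (((P.d - 1 : ℕ) : ℝ) * Mρ * (64 + 138 * 1)) * r ^ 2 := by gcongr
    _ = (202 * ((P.d - 1 : ℕ) : ℝ) * Mρ) * r ^ 2 := by ring

end LetterBounds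

/-! ## §3 The V₀-group current at the record's fibre `M_N(ℂ)`: every letter discharged -/

section Record

open Summit.QuantumFields.YangMills.Theorems.K0Stub1V0SlotAtRecord (exists_W_V0_flat)

/-- **THE V₀-GROUP's `(δ/δA)V₀` ON `PBond P 0 → M_N(ℂ)` AT THE FLAT BACKGROUND WITH EVERY LETTER DISCHARGED**: for every `Params` with `4 ≤ d`,
every `N ≥ 1`, every level `k`: there are the fibre letters `τ = τ_N` (`= ntr`), a dualiser `ρ`, a site dictionary `e` and a map `W` with UST's pointwise
(98)-slot at `a₃ = 1/16`, `c = L^k` and the NUMERICAL constant `C₄ = 202·(d − 1)·N³`, `W` entire, and the (63)∕(27) certificate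
`⟨W(Y), δ⟩ = (d/dt)V₀(Y + tδ)|₀` for pv27's `V0` at `LatticeFieldCalculus.shiftEquiv` (= `torusT P 0`), flat datum, `η = L^{−k}`.
[cite: Balaban1985Variational, Prop. 4 (97)–(98) pp.292–293, (63) p.287, (27) p.282, p.302] -/
theorem exists_W_V0_flat_matrix (N : ℕ) [NeZero N] (P : Params) (hd : 4 ≤ P.d) (k : ℕ)
    [Fact ((0 : ℝ) < (P.L : ℝ))] [Fact ((0 : ℝ) < ((P.L : ℝ))⁻¹ ^ k)] :
    ∃ (τ : Matrix (Fin N) (Fin N) ℂ →L[ℂ] ℂ) (ρ : (Matrix (Fin N) (Fin N) ℂ →L[ℂ] ℂ) →L[ℂ] Matrix (Fin N) (Fin N) ℂ)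
      (e : Site P 0 ≃ B4Sect5Torus.TSite P.d (fun _ => P.sitesPerDir 0))
      (W : (PBond P 0 → Matrix (Fin N) (Fin N) ℂ) → (PBond P 0 → Matrix (Fin N) (Fin N) ℂ)),
      (∀ X, τ X = ntr X) ∧ (∀ ℓ X, τ (ρ ℓ * X) = ℓ X) ∧
      (∀ (x : Site P 0) (μ : Fin P.d), e (x.shift μ) = B9SectCLatticeCarrier.shift μ (e x)) ∧
      (∀ (Y : PBond P 0 → Matrix (Fin N) (Fin N) ℂ) (r : ℝ), r < 1 / 16 → (∀ b, ‖Y b‖ ≤ r) →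
        (∀ (s : Site P 0) (μ ν : Fin P.d), (P.L : ℝ) ^ k * ‖Y ⟨s.shift ν, μ⟩ - Y ⟨s, μ⟩‖ ≤ r) →
        ∀ b, ‖W Y b‖ ≤ (202 * ((P.d - 1 : ℕ) : ℝ) * (N : ℝ) ^ 3) * r ^ 2) ∧
      Differentiable ℂ W ∧
      (∀ (Y δ : PBond P 0 → Matrix (Fin N) (Fin N) ℂ),
        B9Eq39Adjoint.bondPair (((P.L : ℝ))⁻¹ ^ k) P.d (τ : Matrix (Fin N) (Fin N) ℂ →ₗ[ℂ] ℂ) (fun μ x => W Y ⟨x, μ⟩) (fun μ x => δ ⟨x, μ⟩)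
          = deriv (fun t : ℂ => B11Eq26ActionExpansion.V0 (LatticeFieldCalculus.shiftEquiv (P := P) (j := 0))
              (fun _ _ => (1 : (Matrix (Fin N) (Fin N) ℂ)ˣ)) (((P.L : ℝ))⁻¹ ^ k) P.d (τ : Matrix (Fin N) (Fin N) ℂ →ₗ[ℂ] ℂ)
              ((fun μ x => Y ⟨x, μ⟩) + t • fun μ x => δ ⟨x, μ⟩)) 0) := by
  obtain ⟨τ, ρ, hntr, hτ, hτs, hτ1, -, hρ, hρn⟩ := exists_fibreLetters N
  haveI : CompleteSpace (Matrix (Fin N) (Fin N) ℂ) := FiniteDimensional.complete ℂ _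
  obtain ⟨e, W, he, hq, hdiff, hcert⟩ :=
    exists_W_V0_flat_of_letterBound (𝔸 := Matrix (Fin N) (Fin N) ℂ) P hd k ρ τ hρ hτ hτs hτ1 (by positivity) hρn
  exact ⟨τ, ρ, e, W, hntr, hρ, he, hq, hdiff, hcert⟩

end Record

end Summit.QuantumFields.YangMills.Theorems.K0Stub1FibreTraceLetters

end
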